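import Summits.ResolutionOfSingularities.ResolutionOfSingularities.Theorems.WildReflectionLU2
import Summits.ResolutionOfSingularities.ResolutionOfSingularities.Theorems.MonomialBlowupLU4
import HarnessLib

/-!
# WildReflectionLU3 — PART C: the located residual R32, the exact cuts `R31 ↔ R32 ↔ R30 ↔ … ↔ R23`, ROOT BY NAME `closes_wild`

One of the three landing files of the g31 node «ReflectionCut» of the ROOT/RESIDUAL decomposition cell `decomp-res`
(lens 1; Door C (W-wild) of NEXT-g31, critic rows 187 / 213 / 229 and pre-ruling 229a; files `WildReflectionLU`,
`…LU2`, `…LU3`); see the module docstring of `Summits.ResolutionOfSingularities.ResolutionOfSingularities.Theorems.WildReflectionLU` for the thesis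
(Király–Lütkebohmert's theorem on `ℤ/p`-actions with principal augmentation ideal = pseudo-reflections,
[KiralyLutkebohmert2013, Thm. 2 (a) ⇒ (d)], REUSED BY NAME from the tree at a valuation centre), the cell
`WildPseudoReflectionLUAbove k O` and the law `relLU_of_wildPseudoReflectionLUAbove` (in `…LU2`), the costume diff,
the paper instance, the honest scope (a banked SUB-CELL of the wild axis) and the sources.  This file: `not_wildPseudoReflectionLUAbove_of_not_unramifiedWitnessLUAbove` (honest scope of the cut), the cell piece `…TInertTwoMBWildCell` (+ `_holds`), R32 `NonKHToricArchLUKeyHenselDescentQuotTInertTwoMBWild`, `…MBWild_of_mb`, the cuts `_iff_wild`, `…MBWild_of_root`, `closes_wild` (EXACTLY `closes_mb`'s binders with `R31 ↦ R32`), `root_iff_wild_sigma`.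
Imports: the slice `…WildReflectionLU2` and the landed `…MonomialBlowupLU4` (R31, `closes_mb`, `root_iff_mb_sigma`).  Problem side, sorry-free, hypothesis-free (zero fact binders); every heavy theorem carries
`set_option maxHeartbeats … in` BEFORE its docstring — keep it.
-/

noncomputable section

open Literature.AlgebraicGeometry.Resolution
open Summit.ResolutionOfSingularities.ResolutionOfSingularities.Theorems.InertDescentLU
open Summit.ResolutionOfSingularities.ResolutionOfSingularities.Theorems.InvariantDescentLU

universe u

namespace Summit.ResolutionOfSingularities.ResolutionOfSingularities.Theorems.WildReflectionLU

variable {E : Type u} [Field E]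

/-! ## PART C. The located residual `R32` off the wild pseudo-reflection cell, the exact cuts, ROOT BY NAME -/

section CutW

open Summit.ResolutionOfSingularities.ResolutionOfSingularities.Theses
open Summit.ResolutionOfSingularities.ResolutionOfSingularities.Theorems
open Summit.ResolutionOfSingularities.ResolutionOfSingularities.Theorems.KeyChainLU
open Summit.ResolutionOfSingularities.ResolutionOfSingularities.Theorems.HenselKeyChainLU
open Summit.ResolutionOfSingularities.ResolutionOfSingularities.Theorems.GaloisDescentLU
open Summit.ResolutionOfSingularities.ResolutionOfSingularities.Theorems.PfaffLine
open Summit.ResolutionOfSingularities.ResolutionOfSingularities.Theorems.ToricLadder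
open Summit.ResolutionOfSingularities.ResolutionOfSingularities.Theorems.KaplanskyLadder
open Summit.ResolutionOfSingularities.ResolutionOfSingularities.Theorems.PerronLadder
open Summit.ResolutionOfSingularities.ResolutionOfSingularities.Theorems.DefectlessLadder
open Summit.ResolutionOfSingularities.ResolutionOfSingularities.Theorems.WCut
open Summit.ResolutionOfSingularities.ResolutionOfSingularities.Theorems.TameQuotientLU
open Summit.ResolutionOfSingularities.ResolutionOfSingularities.Theorems.DecompositionDescentLU
open Summit.ResolutionOfSingularities.ResolutionOfSingularities.Theorems.InertDescentLU
open Summit.ResolutionOfSingularities.ResolutionOfSingularities.Theorems.TameInertialLU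
open Summit.ResolutionOfSingularities.ResolutionOfSingularities.Theorems.TameTwoStoreyLU
open Summit.ResolutionOfSingularities.ResolutionOfSingularities.Theorems.MonomialBlowupLU

variable {k : Type} [Field k] {K : Type} [Field K] [Algebra k K]

/-- OFF the residue-free-witness cell nothing of the wild pseudo-reflection kind is left either: `¬ UnramifiedWitnessLUAbove → ¬ Wild…`
(the law + `InertDescentLU.unramifiedWitnessLUAbove_of_relLU`).  Honest reading of the cut below: the CLASS of
places of `R32` is the class of `R31`; what moved is the LOCATION of the difficulty for wild `ℤ/p`-layers. [folklore] -/
theorem not_wildPseudoReflectionLUAbove_of_not_unramifiedWitnessLUAbove {O : ValuationSubring K}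
    (h : ¬ UnramifiedWitnessLUAbove k O) : ¬ WildPseudoReflectionLUAbove k O :=
  fun hW => h (unramifiedWitnessLUAbove_of_relLU (relLU_of_wildPseudoReflectionLUAbove hW))

/-- The WILD PSEUDO-REFLECTION CELL PIECE of the residual family (tag DECIDED by
`relLU_of_wildPseudoReflectionLUAbove`): R31's binders together with the cell give relative local uniformization. -/
def NonKHToricArchLUKeyHenselDescentQuotTInertTwoMBWildCell (e c n : ℕ) : Prop :=
  ∀ p : ℕ, p.Prime → ∀ (k K : Type) [Field k] [CharP k p] [Field K] [Algebra k K],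
    Algebra.trdeg k K ≤ n → ∀ O : ValuationSubring K, Nonempty O.valuation.RankOne →
    (∀ y ∈ O, ∃ f : Polynomial k, f ≠ 0 ∧ Polynomial.aeval y f ∈ O.nonunits) →
    ¬ IsAbhyankarPlace O (algebraMap k K).fieldRange ⊤ →
    ¬ (∃ d : ℕ, d < n ∧ SepDenseBelow k O d) → ¬ ToricDenseBelow k O e → ¬ KHTopBelow k O c →
    ¬ KeyChainTopBelow k O → ¬ HenselKeyChainTopBelow k O → ¬ GaloisHenselDescentDatum k O →
    ¬ TameQuotientLU.TameEquivariantLUAbove k O →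
    ¬ DecompositionFieldLUAbove k O → ¬ DecWitnessLUAbove k O → ¬ UnramifiedWitnessLUAbove k O →
    ¬ TameInertialLUAbove k O → ¬ TameOverInertLUAbove k O → ¬ MonomialBlowupAbove k O →
    WildPseudoReflectionLUAbove k O → RelLocalUniformization k K O

/-- THE LAW DECIDES THE CELL PIECE outright (no port, no fact binder, every `d`, every `p`). [folklore] -/
theorem nonKHToricArchLUKeyHenselDescentQuotTInertTwoMBWildCell_holds (e c n : ℕ) :
    NonKHToricArchLUKeyHenselDescentQuotTInertTwoMBWildCell e c n :=
  fun _ _ _ _ _ _ _ _ _ _ _ _ _ _ _ _ _ _ _ _ _ _ _ _ _ _ hw => relLU_of_wildPseudoReflectionLUAbove hw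

/-- **NEW LOCATED RESIDUAL `R32`** (tag UNDECIDED · WEAKER than the root · located at `(e, c, n) = (3, 3, 4)`):
the located residual OFF the key-chain, Hensel, descent, tame-quotient, decomposition-descent, residue-free witness,
tame-inertial, two-storey, monomial-blow-up AND WILD-PSEUDO-REFLECTION cells — in addition to R31's clauses, for NO
Galois extension `K′/K` of degree `p = char k` with a `G`-stable prolongation `O′` of `O` does every f.g. birational
model `R ⊆ O` admit above it a `G`-stable f.g. model `ι(R)[t₀] ⊆ O′`, regular at the centre of `O′`, on which a
generator `g` has PRINCIPAL AUGMENTATION IDEAL with a named generator (`y` in the model with `g y ≠ y` and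
`g b − b ∈ (g y − y)·(model)_𝔪′` for all `b`: Király–Lütkebohmert Thm. 2 condition (a); a pseudo-reflection in the
sense of Lorenzini–Schröer Rem. 6.20, the fixed scheme being the effective Cartier divisor `g y − y = 0`).  KIND
CONSUMED (hypothesis-free, in EVERY dimension `d` and every characteristic, by `relLU_of_wildPseudoReflectionLUAbove`
= the TREE THEOREM [KiralyLutkebohmert2013, Thm. 2 (a) ⇒ (d)] (`KiralyLutkebohmert2013_thm2_regular_of_isPrincipal
…_first_holds …_second_holds`, called BY NAME) at a valuation centre: restriction of `g` to the model's local ring,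
quotient rule, norm trick, then Artin–Tate and transport): the FIRST WILD QUOTIENT SUB-CELL of the programme —
`ℤ/p`-layers (`G = G_Z`, `G_T = G` allowed: Artin–Schreier) whose equivariant regular model carries a
PSEUDO-REFLECTION generator; no root of unity, no `p ∤ e`, no diagonalisation, no `TheoremD k` binder.  It is a
SUB-CELL of the wild `ℤ/p` kind cut out by a MODEL-SIDE clause (critic 229a): the PRODUCTION of PR regular models is
assumed, and the complement inside the wild `ℤ/p` kind contains every top with no PR regular `G`-model cofinal (the
«`p`-unlucky» log-diagonal controls of the module docstring, RelLU there by Π₀ when Abhyankar) and the wild quotient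
singularities with fixed locus of codimension `≥ 2`.  By KL's CONJECTURE 10 (arXiv numbering; Conj. 9 in print —
proved there for `p ≤ 3` and in dimension `≤ 1`, by Serre in the tame case) the PR kind should be the LARGEST wild
cyclic kind that descends regularity model-by-model (`(model)^G` regular at the centre ⇒ augmentation ideal
principal).  HONEST SCOPE OF THE CUT: the extra binder `¬ WildPseudoReflectionLUAbove k O` is IMPLIED by R31's
`¬ UnramifiedWitnessLUAbove k O` (`not_wildPseudoReflectionLUAbove_of_not_unramifiedWitnessLUAbove`: the law + the
g27 iff `UnramifiedWitnessLUAbove ↔ RelLocalUniformization`), exactly as R31 carried `¬ MonomialBlowupAbove` for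
free: the CLASS of places in R32 is the class of R31 — what moved is the LOCATION of the difficulty on the WILD axis:
after R32 a wild cyclic layer of degree `p` asks only for a `G`-stable regular model upstairs WITH A PSEUDO-REFLECTION
GENERATOR, no longer for anything tame, abelian-of-exponent-prime-to-`p`, unramified or `K`-rational.  HONEST LOCATED
REMAINDER (which `O` remain — the class is NOT empty): (β′) wild `ℤ/p`-layers all of whose `G`-stable regular models
above f.g. models of `K` have NON-principal augmentation ideal at the centre — e.g. inertia acting with an ISOLATED
fixed point (ramified precisely at the centre), where the invariant model is SINGULAR by purity of the branch locus:
wild quotient singularities (Artin 1975; Lorenzini–Schröer Def. 6.9 / Thm. 6.10 — their «moderately ramified»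
actions, which are the OPPOSITE geometry and are NOT this cell), whose resolution is Hironaka-strength: in print for
`d = 3` only ([CossartPiltant2019], inside the floor), OPEN for `d ≥ 4` — IDEA-NEEDED, not claimed; (β″) wild layers
with NON-cyclic `p`-inertia (`(ℤ/p)^r`, `r ≥ 2`: already for LINEAR actions regularity of invariants is the modular
invariant theory of Nakajima / Kemper–Malle, not a one-generator condition) and towers mixing (β′) with tame storeys;
(γ) the defect / immediate world ((K-D), (K-c)); (B′) and (α3′) as located in R31's docstring; and, orthogonally, the
PRODUCTION of regular models upstairs (every relative cell's model clause is an INPUT).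
[cite: KiralyLutkebohmert2013, Thm. 2, p. 64; Conj. 10 (arXiv:1001.1945 numbering)] [cite: LorenziniSchroer2019, Def. 6.9, Thm. 6.10, Rem. 6.20, Prop. 6.21]
[cite: Artin1975] [cite: KemperMalle1997] -/
def NonKHToricArchLUKeyHenselDescentQuotTInertTwoMBWild (e c n : ℕ) : Prop :=
  ∀ p : ℕ, p.Prime → ∀ (k K : Type) [Field k] [CharP k p] [Field K] [Algebra k K],
    Algebra.trdeg k K ≤ n → ∀ O : ValuationSubring K, Nonempty O.valuation.RankOne →
    (∀ y ∈ O, ∃ f : Polynomial k, f ≠ 0 ∧ Polynomial.aeval y f ∈ O.nonunits) →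
    ¬ IsAbhyankarPlace O (algebraMap k K).fieldRange ⊤ →
    ¬ (∃ d : ℕ, d < n ∧ SepDenseBelow k O d) → ¬ ToricDenseBelow k O e → ¬ KHTopBelow k O c →
    ¬ KeyChainTopBelow k O → ¬ HenselKeyChainTopBelow k O → ¬ GaloisHenselDescentDatum k O →
    ¬ TameQuotientLU.TameEquivariantLUAbove k O →
    ¬ DecompositionFieldLUAbove k O → ¬ DecWitnessLUAbove k O → ¬ UnramifiedWitnessLUAbove k O →
    ¬ TameInertialLUAbove k O → ¬ TameOverInertLUAbove k O → ¬ MonomialBlowupAbove k O →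
    ¬ WildPseudoReflectionLUAbove k O → RelLocalUniformization k K O

/-- Dropping the negated wild hypothesis: `R31 → R32`. [folklore] -/
theorem nonKHToricArchLUKeyHenselDescentQuotTInertTwoMBWild_of_mb {e c n : ℕ}
    (h : NonKHToricArchLUKeyHenselDescentQuotTInertTwoMB e c n) :
    NonKHToricArchLUKeyHenselDescentQuotTInertTwoMBWild e c n :=
  fun p hp k K _ _ _ _ hd O h1 h0 hA hnd hnt hnk hkey hH hG hT hDF hDW hU hI h2 hMB _ =>
    h p hp k K hd O h1 h0 hA hnd hnt hnk hkey hH hG hT hDF hDW hU hI h2 hMB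

/-- **THE WILD CUT** (kernel, exact, hypothesis-free): the g30 located residual `R31` is EQUIVALENT to its part off
the wild pseudo-reflection cell — on the cell the law `relLU_of_wildPseudoReflectionLUAbove` decides (case split on
`WildPseudoReflectionLUAbove k O`). [folklore] -/
theorem nonKHToricArchLUKeyHenselDescentQuotTInertTwoMB_iff_wild {e c n : ℕ} :
    NonKHToricArchLUKeyHenselDescentQuotTInertTwoMB e c n ↔
      NonKHToricArchLUKeyHenselDescentQuotTInertTwoMBWild e c n := by
  refine ⟨nonKHToricArchLUKeyHenselDescentQuotTInertTwoMBWild_of_mb,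
    fun h p hp k K _ _ _ _ hd O hr hz hA hnd hnt hnk hkey hH hG hT hDF hDW hU hI h2 hMB => ?_⟩
  by_cases hw : WildPseudoReflectionLUAbove k O
  · exact relLU_of_wildPseudoReflectionLUAbove hw
  exact h p hp k K hd O hr hz hA hnd hnt hnk hkey hH hG hT hDF hDW hU hI h2 hMB hw

/-- The same cut WITHOUT a case split: R32's extra binder is implied by R31's `¬ UnramifiedWitnessLUAbove`
(`not_wildPseudoReflectionLUAbove_of_not_unramifiedWitnessLUAbove`) — the honest reading of the cut: the class of
places did not shrink, the difficulty was re-located on the wild axis. [folklore] -/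
theorem nonKHToricArchLUKeyHenselDescentQuotTInertTwoMB_of_wild {e c n : ℕ}
    (h : NonKHToricArchLUKeyHenselDescentQuotTInertTwoMBWild e c n) :
    NonKHToricArchLUKeyHenselDescentQuotTInertTwoMB e c n :=
  fun p hp k K _ _ _ _ hd O hr hz hA hnd hnt hnk hkey hH hG hT hDF hDW hU hI h2 hMB =>
    h p hp k K hd O hr hz hA hnd hnt hnk hkey hH hG hT hDF hDW hU hI h2 hMB
      (not_wildPseudoReflectionLUAbove_of_not_unramifiedWitnessLUAbove hU)

/-- The EXACT re-location at the programme's parameters `(3, 3, 4)` (`R31 ↔ R32`, hypothesis-free). [folklore] -/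
theorem nonKHToricArchLUKeyHenselDescentQuotTInertTwoMB334_iff_wild :
    NonKHToricArchLUKeyHenselDescentQuotTInertTwoMB 3 3 4 ↔
      NonKHToricArchLUKeyHenselDescentQuotTInertTwoMBWild 3 3 4 :=
  nonKHToricArchLUKeyHenselDescentQuotTInertTwoMB_iff_wild

/-- The g29 located residual `R30` re-located in one step (`R30 ↔ R32`). [folklore] -/
theorem nonKHToricArchLUKeyHenselDescentQuotTInertTwo_iff_wild {e c n : ℕ} :
    NonKHToricArchLUKeyHenselDescentQuotTInertTwo e c n ↔
      NonKHToricArchLUKeyHenselDescentQuotTInertTwoMBWild e c n :=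
  nonKHToricArchLUKeyHenselDescentQuotTInertTwo_iff_mb.trans nonKHToricArchLUKeyHenselDescentQuotTInertTwoMB_iff_wild

/-- The g28 located residual `R29` re-located (`R29 ↔ R32`). [folklore] -/
theorem nonKHToricArchLUKeyHenselDescentQuotTInert_iff_wild {e c n : ℕ} :
    NonKHToricArchLUKeyHenselDescentQuotTInert e c n ↔ NonKHToricArchLUKeyHenselDescentQuotTInertTwoMBWild e c n :=
  nonKHToricArchLUKeyHenselDescentQuotTInert_iff_mb.trans nonKHToricArchLUKeyHenselDescentQuotTInertTwoMB_iff_wild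

/-- The g28 located residual `R28` re-located (`R28 ↔ R32`). [folklore] -/
theorem nonKHToricArchLUKeyHenselDescentQuotInert_iff_wild {e c n : ℕ} :
    NonKHToricArchLUKeyHenselDescentQuotInert e c n ↔ NonKHToricArchLUKeyHenselDescentQuotTInertTwoMBWild e c n :=
  nonKHToricArchLUKeyHenselDescentQuotInert_iff_mb.trans nonKHToricArchLUKeyHenselDescentQuotTInertTwoMB_iff_wild

/-- The g25 located residual re-located (`R25 ↔ R32`). [folklore] -/
theorem nonKHToricArchLUKeyHenselDescentQuot_iff_wild {e c n : ℕ} :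
    NonKHToricArchLUKeyHenselDescentQuot e c n ↔ NonKHToricArchLUKeyHenselDescentQuotTInertTwoMBWild e c n :=
  nonKHToricArchLUKeyHenselDescentQuot_iff_mb.trans nonKHToricArchLUKeyHenselDescentQuotTInertTwoMB_iff_wild

/-- The g23 located residual re-located (`R23 ↔ R32`). [folklore] -/
theorem nonKHToricArchLUKeyHenselDescent_iff_wild {e c n : ℕ} :
    NonKHToricArchLUKeyHenselDescent e c n ↔ NonKHToricArchLUKeyHenselDescentQuotTInertTwoMBWild e c n :=
  nonKHToricArchLUKeyHenselDescent_iff_mb.trans nonKHToricArchLUKeyHenselDescentQuotTInertTwoMB_iff_wild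

/-- The TRUE residual family of g17/g20 (`NonKHToricArchLU`) re-located off all ten cells. [folklore] -/
theorem nonKHToricArchLU_iff_wild {e c n : ℕ} :
    NonKHToricArchLU e c n ↔ NonKHToricArchLUKeyHenselDescentQuotTInertTwoMBWild e c n :=
  nonKHToricArchLU_iff_mb.trans nonKHToricArchLUKeyHenselDescentQuotTInertTwoMB_iff_wild

/-- The new residual follows from the root outright (it is a WEAKER piece). [folklore] -/
theorem nonKHToricArchLUKeyHenselDescentQuotTInertTwoMBWild_of_root (hS : _root_.ResolutionOfSingularities)
    (e c n : ℕ) : NonKHToricArchLUKeyHenselDescentQuotTInertTwoMBWild e c n :=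
  nonKHToricArchLUKeyHenselDescentQuotTInertTwoMBWild_of_mb
    (nonKHToricArchLUKeyHenselDescentQuotTInertTwoMB_of_root hS e c n)

/-- **`closes_wild` — ROOT BY NAME (binders PRINTED, = `closes_mb`'s with `R31 ↦ R32`):**
`(hCP : CossartPiltant2019LU3)` the Cossart–Piltant dimension-3 floor (print) ·
`(hCJS : CossartJannsenSaito2020Embedded)` embedded resolution of excellent surfaces (named fact) ·
`(hAsc : KK05NCVAscent)` the Knaf–Kuhlmann (NC)+(V) ascent Π₁ (print) · `(hN : ∀ d ≥ 4, R32 3 3 d)` the located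
residual OFF the key-chain, Hensel, descent, tame-quotient, decomposition-descent, residue-free witness,
tame-inertial, two-storey, monomial-blow-up AND wild-pseudo-reflection cells · `(h₃ : Valuative.PatchingRel)` the
patching crux 0642 ⇒ `ResolutionOfSingularities`.  All ten cells are discharged INSIDE the kernel. [folklore] -/
theorem closes_wild (hCP : CossartPiltant2019LU3.{0}) (hCJS : CossartJannsenSaito2020Embedded.{0})
    (hAsc : KK05NCVAscent) (hN : ∀ d, 4 ≤ d → NonKHToricArchLUKeyHenselDescentQuotTInertTwoMBWild 3 3 d)
    (h₃ : Valuative.PatchingRel) : _root_.ResolutionOfSingularities :=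
  closes_mb hCP hCJS hAsc (fun d hd => nonKHToricArchLUKeyHenselDescentQuotTInertTwoMB_iff_wild.2 (hN d hd)) h₃

/-- Root-level summary: modulo floor + CJS + Π₁ + 0642 the ROOT is EQUIVALENT to the residual family off the ten
cells. [folklore] -/
theorem root_iff_wild_sigma (hCP : CossartPiltant2019LU3.{0})
    (hCJS : CossartJannsenSaito2020Embedded.{0}) (hAsc : KK05NCVAscent) (h₃ : Valuative.PatchingRel) :
    _root_.ResolutionOfSingularities ↔ ∀ d, 4 ≤ d → NonKHToricArchLUKeyHenselDescentQuotTInertTwoMBWild 3 3 d := by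
  rw [root_iff_mb_sigma hCP hCJS hAsc h₃]
  exact forall₂_congr fun d _ => nonKHToricArchLUKeyHenselDescentQuotTInertTwoMB_iff_wild

end CutW

end Summit.ResolutionOfSingularities.ResolutionOfSingularities.Theorems.WildReflectionLU

end
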